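import Summits.ResolutionOfSingularities.ResolutionOfSingularities.Theorems.EigenLadderLU2B
import HarnessLib

/-!
[WRITER NOTE (decomp-res writer g12): imports `EigenLadderLU2B` (the 400-line split of the lens's
`EigenLadderLU2`) instead of `EigenLadderLU2`; content otherwise verbatim.]

# EigenLadderLU (3) — PART B2 (orbit cocycle from one step, `eigenFrame_of_stableFlag`) and PART D0
(field-theoretic helpers for the laws)
-/

namespace Summit.ResolutionOfSingularities.ResolutionOfSingularities.Theorems.EigenLadderLU

open Literature.AlgebraicGeometry.Resolution
open Summit.ResolutionOfSingularities.ResolutionOfSingularities.Theorems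
open Summit.ResolutionOfSingularities.ResolutionOfSingularities.Theorems.AdaptedChartHensel
open Summit.ResolutionOfSingularities.ResolutionOfSingularities.Theorems.KeyChainLU

/-! ## PART B2 — the orbit cocycle from ONE step: «the hyperplane `(u₀)` is `σ`-stable with residual
eigenvalue `ζ`» unrolled along `⟨σ⟩` -/

section Cocycle

variable {k : Type} [Field k] {L : Type} [Field L] [Algebra k L]

/-- `σ`-stability of `O'` transports units: `v'(z) = 1 ⇒ v'(σ z) = 1`. [folklore] -/
theorem valuation_sigma_eq_one (σ : L ≃ₐ[k] L) (O' : ValuationSubring L)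
    (hσO' : ∀ y, y ∈ O' ↔ σ y ∈ O') {z : L} (hz : O'.valuation z = 1) :
    O'.valuation (σ z) = 1 := by
  have hz0 : z ≠ 0 := fun h => by rw [h, map_zero] at hz; exact zero_ne_one hz
  have h1 : σ z ∈ O' := (hσO' z).mp ((O'.valuation_le_one_iff _).mp hz.le)
  have h2 : σ z⁻¹ ∈ O' :=
    (hσO' _).mp ((O'.valuation_le_one_iff _).mp (by rw [map_inv₀, hz, inv_one]))
  rw [map_inv₀] at h2
  have h3 := (O'.valuation_le_one_iff _).mpr h2
  rw [map_inv₀] at h3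
  have h4 := (O'.valuation_le_one_iff _).mpr h1
  have hσz0 : 0 < O'.valuation (σ z) := by
    rw [zero_lt_iff, Valuation.ne_zero_iff]; exact (map_ne_zero σ).mpr hz0
  exact le_antisymm h4 ((inv_le_one₀ hσz0).mp h3)

/-- `σ`-stability of `O'` transports the maximal ideal: `v'(z) < 1 ⇒ v'(σ z) < 1`. [folklore] -/
theorem valuation_sigma_lt_one (σ : L ≃ₐ[k] L) (O' : ValuationSubring L)
    (hσO' : ∀ y, y ∈ O' ↔ σ y ∈ O') {z : L} (hz : O'.valuation z < 1) :
    O'.valuation (σ z) < 1 := by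
  by_cases hz0 : z = 0
  · rw [hz0, map_zero, map_zero]; exact zero_lt_one
  have h1 : σ z ∈ O' := (hσO' z).mp ((O'.valuation_le_one_iff _).mp hz.le)
  have h4 := (O'.valuation_le_one_iff _).mpr h1
  refine lt_of_le_of_ne h4 fun heq => ?_
  -- `σ z` a unit ⇒ `z` a unit
  have h2 : (σ z)⁻¹ ∈ O' := (O'.valuation_le_one_iff _).mp (by rw [map_inv₀, heq, inv_one])
  rw [← map_inv₀, ← hσO'] at h2
  have h3 := (O'.valuation_le_one_iff _).mpr h2
  rw [map_inv₀] at h3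
  have hvz0 : 0 < O'.valuation z := by rw [zero_lt_iff, Valuation.ne_zero_iff]; exact hz0
  exact absurd ((inv_le_one₀ hvz0).mp h3) (not_le.mpr hz)

/-- **THE ORBIT COCYCLE FROM ONE STEP.**  If the hyperplane `(u₀)` is `σ`-STABLE in the chart — one
relation `σ(u₀) · b₁ = a₁ · u₀` with `a₁, b₁ ∈ A`, `b₁` a unit of `O'` — with RESIDUAL EIGENVALUE `ζ`
(`a₁ ≡ ζ b₁ (mod 𝔪')`), then along the whole group `σⁱ(u₀) · bᵢ = aᵢ · u₀` with `aᵢ ≡ ζⁱ bᵢ`: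
`a_{i+1} = σ(aᵢ) a₁`, `b_{i+1} = σ(bᵢ) b₁` (PART B's hypothesis in its natural one-step form).
[folklore] -/
theorem orbitCocycle_of_step (σ : L ≃ₐ[k] L) (O' : ValuationSubring L)
    (hσO' : ∀ y, y ∈ O' ↔ σ y ∈ O') (A : Subalgebra k L) (hAO : A.toSubring ≤ O'.toSubring)
    (hAσ : ∀ a ∈ A, σ a ∈ A) (u₀ : L) (ζ : k) (a₁ b₁ : L) (ha₁ : a₁ ∈ A) (hb₁ : b₁ ∈ A)
    (hb₁1 : O'.valuation b₁ = 1) (hstep : σ u₀ * b₁ = a₁ * u₀)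
    (hres₁ : O'.valuation (a₁ - algebraMap k L ζ * b₁) < 1) :
    ∃ a b : ℕ → L, (∀ i, a i ∈ A) ∧ (∀ i, b i ∈ A) ∧ (∀ i, O'.valuation (b i) = 1) ∧
      (∀ i, (σ ^ i) u₀ * b i = a i * u₀) ∧
      (∀ i, O'.valuation (a i - algebraMap k L (ζ ^ i) * b i) < 1) := by
  have hvle : ∀ z ∈ A, O'.valuation z ≤ 1 := fun z hz => (O'.valuation_le_one_iff _).mpr (hAO hz)
  let ab : ℕ → L × L := fun i => Nat.rec ((1 : L), (1 : L)) (fun _ p => (σ p.1 * a₁, σ p.2 * b₁)) i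
  let a : ℕ → L := fun i => (ab i).1
  let b : ℕ → L := fun i => (ab i).2
  have ha0 : a 0 = 1 := rfl
  have hb0 : b 0 = 1 := rfl
  have has : ∀ i, a (i + 1) = σ (a i) * a₁ := fun _ => rfl
  have hbs : ∀ i, b (i + 1) = σ (b i) * b₁ := fun _ => rfl
  have hA1 : ∀ i, a i ∈ A := by
    intro i
    induction i with
    | zero => rw [ha0]; exact A.one_mem
    | succ i ih => rw [has]; exact A.mul_mem (hAσ _ ih) ha₁
  have hB1 : ∀ i, b i ∈ A := by
    intro i
    induction i with
    | zero => rw [hb0]; exact A.one_mem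
    | succ i ih => rw [hbs]; exact A.mul_mem (hAσ _ ih) hb₁
  have hb1 : ∀ i, O'.valuation (b i) = 1 := by
    intro i
    induction i with
    | zero => rw [hb0]; exact map_one _
    | succ i ih => rw [hbs, map_mul, valuation_sigma_eq_one σ O' hσO' ih, hb₁1, one_mul]
  have horb : ∀ i, (σ ^ i) u₀ * b i = a i * u₀ := by
    intro i
    induction i with
    | zero => rw [ha0, hb0, pow_zero, AlgEquiv.one_apply, mul_one, one_mul]
    | succ i ih =>
      have h := congrArg σ ih
      rw [map_mul, map_mul] at h
      -- `σ^{i+1} u₀ · σ bᵢ · b₁ = σ aᵢ · σ u₀ · b₁ = σ aᵢ · a₁ · u₀`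
      rw [has, hbs, pow_succ_apply, ← mul_assoc, h, mul_assoc, hstep, ← mul_assoc]
  have hres : ∀ i, O'.valuation (a i - algebraMap k L (ζ ^ i) * b i) < 1 := by
    intro i
    induction i with
    | zero => rw [ha0, hb0, pow_zero, map_one, mul_one, sub_self, map_zero]; exact zero_lt_one
    | succ i ih =>
      have hdec : a (i + 1) - algebraMap k L (ζ ^ (i + 1)) * b (i + 1) =
          σ (a i) * (a₁ - algebraMap k L ζ * b₁) +
            algebraMap k L ζ * b₁ * σ (a i - algebraMap k L (ζ ^ i) * b i) := by
        rw [has, hbs, map_sub, map_mul σ, AlgEquiv.commutes, pow_succ, map_mul]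
        ring
      rw [hdec]
      refine Valuation.map_add_lt _ ?_ ?_
      · rw [map_mul]
        calc O'.valuation (σ (a i)) * O'.valuation (a₁ - algebraMap k L ζ * b₁)
            ≤ 1 * O'.valuation (a₁ - algebraMap k L ζ * b₁) :=
              mul_le_mul_left (hvle _ (hAσ _ (hA1 i))) _
          _ < 1 := by rw [one_mul]; exact hres₁
      · rw [map_mul]
        calc O'.valuation (algebraMap k L ζ * b₁) *
              O'.valuation (σ (a i - algebraMap k L (ζ ^ i) * b i))
            ≤ 1 * O'.valuation (σ (a i - algebraMap k L (ζ ^ i) * b i)) :=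
              mul_le_mul_left (hvle _ (A.mul_mem (A.algebraMap_mem ζ) hb₁)) _
          _ < 1 := by rw [one_mul]; exact valuation_sigma_lt_one σ O' hσO' ih
  exact ⟨a, b, hA1, hB1, hb1, horb, hres⟩


/-- **FULL EIGEN-FRAME LAW (PART B2, all coordinates, arbitrary characters)** — iterate the one-coordinate
law: if EVERY coordinate hyperplane `(u_j)` of the chart is `⟨σ⟩`-stable to first order with residual
eigenvalue `ζ^{t_j}` (one-step form: `σ(u_j) · b_j = a_j · u_j`, `a_j, b_j ∈ A`, `v'(b_j) = 0`,
`a_j ≡ ζ^{t_j} b_j`; `O'` `σ`-stable so that the cocycle propagates, PART B2), then the chart carries an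
EIGEN-FRAME `x` with the SAME values presenting the SAME maximal ideal: `σ x_j = ζ^{t_j} x_j` for all
`j`.  No coordinate of the frame is given in advance. [CossartPiltant2008, Prop. 6.2] [folklore] -/
theorem eigenFrame_of_stableFlag (σ : L ≃ₐ[k] L) {ℓ : ℕ} (hℓ : 0 < ℓ) (hℓk : (ℓ : k) ≠ 0)
    (hσℓ : σ ^ ℓ = 1) {ζ : k} (hζℓ : ζ ^ ℓ = 1) (O' : ValuationSubring L)
    (hσO' : ∀ y, y ∈ O' ↔ σ y ∈ O')
    (A : Subalgebra k L) (hAO : A.toSubring ≤ O'.toSubring) (hAσ : ∀ a ∈ A, σ a ∈ A)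
    (u : Fin 4 → L) (hu : ∀ i, u i ∈ A)
    (hmax : IsLocalRing.maximalIdeal (Localization.AtPrime (centreIdeal A O' hAO)) =
      Ideal.span (Set.range fun i =>
        algebraMap A (Localization.AtPrime (centreIdeal A O' hAO)) ⟨u i, hu i⟩))
    (t : Fin 4 → ℕ) (a₁ b₁ : Fin 4 → L) (ha₁ : ∀ j, a₁ j ∈ A) (hb₁ : ∀ j, b₁ j ∈ A)
    (hb₁1 : ∀ j, O'.valuation (b₁ j) = 1) (hstep : ∀ j, σ (u j) * b₁ j = a₁ j * u j)
    (hres₁ : ∀ j, O'.valuation (a₁ j - algebraMap k L (ζ ^ t j) * b₁ j) < 1) :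
    ∃ (x : Fin 4 → L) (hx : ∀ i, x i ∈ A),
      (∀ j, x j = reynolds σ ((ζ ^ t j) ^ (ℓ - 1)) ℓ 1 (u j)) ∧
      (∀ j, σ (x j) = algebraMap k L (ζ ^ t j) * x j) ∧
      (∀ i, O'.valuation (x i) = O'.valuation (u i)) ∧
      IsLocalRing.maximalIdeal (Localization.AtPrime (centreIdeal A O' hAO)) =
        Ideal.span (Set.range fun i =>
          algebraMap A (Localization.AtPrime (centreIdeal A O' hAO)) ⟨x i, hx i⟩) := by
  -- induction on the number `n` of treated coordinates
  have key : ∀ n : ℕ, n ≤ 4 → ∃ (x : Fin 4 → L) (hx : ∀ i, x i ∈ A),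
      (∀ j : Fin 4, (j : ℕ) < n → x j = reynolds σ ((ζ ^ t j) ^ (ℓ - 1)) ℓ 1 (u j)) ∧
      (∀ j : Fin 4, n ≤ (j : ℕ) → x j = u j) ∧
      (∀ i, O'.valuation (x i) = O'.valuation (u i)) ∧
      IsLocalRing.maximalIdeal (Localization.AtPrime (centreIdeal A O' hAO)) =
        Ideal.span (Set.range fun i =>
          algebraMap A (Localization.AtPrime (centreIdeal A O' hAO)) ⟨x i, hx i⟩) := by
    intro n
    induction n with
    | zero => exact fun _ => ⟨u, hu, fun j hj => absurd hj (Nat.not_lt_zero _), fun j _ => rfl,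
        fun _ => rfl, hmax⟩
    | succ n ih =>
      intro hn
      obtain ⟨x, hx, hxlt, hxge, hxv, hxmax⟩ := ih (Nat.le_of_succ_le hn)
      -- treat coordinate `j₀ = n`
      let j₀ : Fin 4 := ⟨n, Nat.lt_of_succ_le hn⟩
      have hj₀ : (j₀ : ℕ) = n := rfl
      have hxj₀ : x j₀ = u j₀ := hxge j₀ (by rw [hj₀])
      obtain ⟨a, b, haA, hbA, hb1, horb, hres⟩ := orbitCocycle_of_step σ O' hσO' A hAO hAσ (u j₀)
        (ζ ^ t j₀) (a₁ j₀) (b₁ j₀) (ha₁ j₀) (hb₁ j₀) (hb₁1 j₀) (hstep j₀) (hres₁ j₀)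
      have horb' : ∀ i, i < ℓ → (σ ^ i) (x j₀) * b i = a i * x j₀ := fun i _ => by
        rw [hxj₀]; exact horb i
      have hres' : ∀ i, i < ℓ → O'.valuation (a i - algebraMap k L ((ζ ^ t j₀) ^ i) * b i) < 1 :=
        fun i _ => hres i
      have hζt : (ζ ^ t j₀) ^ ℓ = 1 := by rw [← pow_mul, mul_comm, pow_mul, hζℓ, one_pow]
      obtain ⟨x', hx', hx'j, hx'ne, -, hx'v, hx'max⟩ := eigenCoordinate_of_stableHyperplane σ hℓ hℓk
        hσℓ hζt O' A hAO hAσ x hx hxmax j₀ a b (fun i _ => haA i) (fun i _ => hbA i)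
        (fun i _ => hb1 i) horb' hres'
      refine ⟨x', hx', ?_, ?_, fun i => (hx'v i).trans (hxv i), hx'max⟩
      · intro j hj
        by_cases hjj : j = j₀
        · rw [hjj, hx'j, hxj₀]
        · have hjn : (j : ℕ) < n := by
            have hne : (j : ℕ) ≠ n := fun h => hjj (Fin.ext (by rw [h, hj₀]))
            omega
          rw [hx'ne j hjj, hxlt j hjn]
      · intro j hj
        have hjj : j ≠ j₀ := fun h => by rw [h, hj₀] at hj; omega
        rw [hx'ne j hjj, hxge j (by omega)]
  obtain ⟨x, hx, hxlt, -, hxv, hxmax⟩ := key 4 le_rfl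
  have hxall : ∀ j : Fin 4, x j = reynolds σ ((ζ ^ t j) ^ (ℓ - 1)) ℓ 1 (u j) := fun j => hxlt j j.2
  refine ⟨x, hx, hxall, fun j => ?_, hxv, hxmax⟩
  have hζt : (ζ ^ t j) ^ ℓ = 1 := by rw [← pow_mul, mul_comm, pow_mul, hζℓ, one_pow]
  have hζζ' : ζ ^ t j * (ζ ^ t j) ^ (ℓ - 1) = 1 := by
    rw [← pow_succ', Nat.sub_add_cancel hℓ, hζt]
  have h := sigma_reynolds σ hℓ hσℓ (ζ ^ t j) ((ζ ^ t j) ^ (ℓ - 1)) hζζ' hζt 1 (u j)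
  rw [pow_one] at h
  rw [hxall j]
  exact h

end Cocycle

end Summit.ResolutionOfSingularities.ResolutionOfSingularities.Theorems.EigenLadderLU

namespace Summit.ResolutionOfSingularities.ResolutionOfSingularities.Theorems.EigenLadderLU

open Polynomial
open Literature.AlgebraicGeometry.Resolution
open Summit.ResolutionOfSingularities.ResolutionOfSingularities.Theorems
open Summit.ResolutionOfSingularities.ResolutionOfSingularities.Theorems.AdaptedChartHensel
open Summit.ResolutionOfSingularities.ResolutionOfSingularities.Theorems.GaloisDescentLU
open Summit.ResolutionOfSingularities.ResolutionOfSingularities.Theorems.KeyChainLU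

/-! ## PART D0 — field-theoretic helpers for the laws -/

section Helpers

variable {F : Type} [Field F] {E : Type} [Field E] [Algebra F E]

/-- **A simple root of a monic polynomial with coefficients in a subfield is integral and separable
over it** (if the minimal polynomial were inseparable, `p' = 0`, then `f = p q` gives
`f'(η) = p(η) q'(η) = 0`). [folklore] -/
theorem isIntegral_and_isSeparable_of_simple_root (S : IntermediateField F E) (η : E) (f : E[X])
    (hf : ∀ i, f.coeff i ∈ S) (hmon : f.Monic) (hfη : f.eval η = 0)
    (hder : (derivative f).eval η ≠ 0) : IsIntegral S η ∧ IsSeparable S η := by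
  have hlifts : f ∈ Polynomial.lifts (algebraMap S E) :=
    (Polynomial.lifts_iff_coeff_lifts _).mpr fun n => ⟨⟨f.coeff n, hf n⟩, rfl⟩
  obtain ⟨f₁, hf₁, -, hf₁mon⟩ := Polynomial.lifts_and_degree_eq_and_monic hlifts hmon
  have hf₁η : Polynomial.aeval η f₁ = 0 := by
    rw [Polynomial.aeval_def, ← Polynomial.eval_map, hf₁, hfη]
  have hint : IsIntegral S η := ⟨f₁, hf₁mon, by rw [← Polynomial.aeval_def, hf₁η]⟩
  refine ⟨hint, ?_⟩
  obtain ⟨q, hq⟩ := minpoly.dvd S η hf₁η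
  change (minpoly S η).Separable
  rw [Polynomial.separable_iff_derivative_ne_zero (minpoly.irreducible hint)]
  intro hd0
  apply hder
  have hfq : f = (minpoly S η * q).map (algebraMap S E) := by rw [← hq, hf₁]
  rw [hfq, Polynomial.derivative_map, Polynomial.derivative_mul, hd0, zero_mul, zero_add,
    Polynomial.eval_map, Polynomial.eval₂_mul, ← Polynomial.aeval_def, minpoly.aeval, zero_mul]

/-- **An `ℓ`-th root of a non-zero element is integral and separable when `ℓ ≠ 0` in the field.**
[folklore] -/
theorem isIntegral_and_isSeparable_of_pow_mem (S : IntermediateField F E) (x : E) {ℓ : ℕ}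
    (hℓ : 0 < ℓ) (hℓS : ((ℓ : ℕ) : E) ≠ 0) (hx0 : x ≠ 0) (hxS : x ^ ℓ ∈ S) :
    IsIntegral S x ∧ IsSeparable S x := by
  let c : S := ⟨x ^ ℓ, hxS⟩
  have hc0 : c ≠ 0 := fun h => pow_ne_zero ℓ hx0 (congrArg Subtype.val h)
  have hℓS' : ((ℓ : ℕ) : S) ≠ 0 := fun h => hℓS (by
    have := congrArg (algebraMap S E) h
    rwa [map_natCast, map_zero] at this)
  have hroot : Polynomial.aeval x (X ^ ℓ - C c : S[X]) = 0 := by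
    rw [map_sub, Polynomial.aeval_X_pow, Polynomial.aeval_C]
    exact sub_self _
  have hint : IsIntegral S x := ⟨X ^ ℓ - C c, Polynomial.monic_X_pow_sub_C c hℓ.ne', by
    rw [← Polynomial.aeval_def, hroot]⟩
  refine ⟨hint, ?_⟩
  change (minpoly S x).Separable
  exact (Polynomial.separable_X_pow_sub_C c hℓS' hc0).of_dvd (minpoly.dvd S x hroot)

end Helpers

end Summit.ResolutionOfSingularities.ResolutionOfSingularities.Theorems.EigenLadderLU
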